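import Summits.QuantumAdvantage.QuantumAdvantage.Theorems.LivenessSeparationLawJ

set_option linter.dupNamespace false

/-!
# LIVENESS SEPARATION, part O (lens 4, g28 cycle 4d) — the liveness design for a FINSET of cuts and in BLOCK FORM

Blocker `X = AbsorptionDial.NoPerfectPolyOdd` (item 28487); NODE-g28 §5g.  Part N's `livenessDesign` (cuts as a 2-separated sequence) restated for a
2-separated `Q : Finset (Fin (n+1))` via its sorted enumeration `cutSeq` (`Finset.orderEmbOfFin`), and in the block form `fill ρ (blockEmb a₀ m h) v₀`
of parts J / M (`fill_restrict`: refilling a block with the bits already there changes nothing).  ★ `livenessDesign_block` supplies exactly the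
hypotheses `hlive₀` / `hdead` of part M's `loss_of_designedClassRectangle`.
-/

open Finset
open Summit.QuantumAdvantage.AdviceFreeQNC0
open Summit.QuantumAdvantage.QuantumAdvantage.Theorems.InnerDegreeDial

namespace Summit.QuantumAdvantage.QuantumAdvantage.Theorems.LivenessSeparation

variable {n : ℕ}

/-! ### from a finite set of cuts, and in the block form of parts J / M -/

section FinsetForm

/-- the sorted enumeration of a set of `T` cuts, as a sequence `ℕ → ℕ` (extended by `0`) -/
def cutSeq (Q : Finset (Fin (n + 1))) {T : ℕ} (hT : Q.card = T) (l : ℕ) : ℕ :=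
  if h : l < T then (Q.orderEmbOfFin hT ⟨l, h⟩).val else 0

variable {Q : Finset (Fin (n + 1))} {T : ℕ}

/-- the enumeration inside the range -/
theorem cutSeq_eq (hT : Q.card = T) {l : ℕ} (h : l < T) : cutSeq Q hT l = (Q.orderEmbOfFin hT ⟨l, h⟩).val :=
  dif_pos h

/-- 2-separation of the set gives 2-separation of the sequence -/
theorem cutSeq_sep (hT : Q.card = T) (hsep : ∀ q ∈ Q, ∀ q' ∈ Q, q < q' → q.val + 2 ≤ q'.val) (j : ℕ) (hj : j + 1 < T) :
    cutSeq Q hT j + 2 ≤ cutSeq Q hT (j + 1) := by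
  rw [cutSeq_eq hT (by omega), cutSeq_eq hT hj]
  exact hsep _ (Finset.orderEmbOfFin_mem Q hT _) _ (Finset.orderEmbOfFin_mem Q hT _)
    ((Q.orderEmbOfFin hT).strictMono (Fin.mk_lt_mk.mpr (by omega)))

/-- the cuts lie in `[0, n]` -/
theorem cutSeq_le (hT : Q.card = T) (l : ℕ) : cutSeq Q hT l ≤ n := by
  unfold cutSeq
  split_ifs with h
  · exact Nat.lt_succ_iff.mp (Q.orderEmbOfFin hT ⟨l, h⟩).isLt
  · omega

/-- every member of the set is enumerated -/
theorem cutSeq_surj (hT : Q.card = T) {q : Fin (n + 1)} (hq : q ∈ Q) : ∃ l, ∃ h : l < T, Q.orderEmbOfFin hT ⟨l, h⟩ = q := by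
  have hq' : q ∈ Set.range (Q.orderEmbOfFin hT) := by
    rw [Finset.range_orderEmbOfFin]
    exact hq
  obtain ⟨i, hi⟩ := hq'
  exact ⟨i.1, i.2, hi⟩

/-- **LIVENESS DESIGN for a 2-separated set of cuts** (not the ends pair `{0, n}` with `n ≡ c`, board length `n ≥ 2`): some input makes one member live
and every other member dead. -/
theorem livenessDesign_finset (c : ℕ) (hn : 2 ≤ n) (Q : Finset (Fin (n + 1))) (hne : Q.Nonempty)
    (hsep : ∀ q ∈ Q, ∀ q' ∈ Q, q < q' → q.val + 2 ≤ q'.val) (hends : ¬ (Q = {0, Fin.last n} ∧ n % 3 = c % 3)) :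
    ∃ u : Fin n → Bool, ∃ g₀ ∈ Q, liveCut c u g₀ = true ∧ ∀ q ∈ Q, q ≠ g₀ → liveCut c u q = false := by
  classical
  obtain ⟨T, hT⟩ : ∃ T, Q.card = T := ⟨_, rfl⟩
  have hT1 : 1 ≤ T := by
    rw [← hT]
    exact Finset.card_pos.mpr hne
  have hends' : ¬ (T = 2 ∧ cutSeq Q hT 0 = 0 ∧ cutSeq Q hT 1 = n ∧ n % 3 = c % 3) := by
    rintro ⟨hT2, h0, h1, hmod⟩
    subst hT2
    apply hends
    refine ⟨?_, hmod⟩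
    have e0 : Q.orderEmbOfFin hT ⟨0, by omega⟩ = 0 :=
      Fin.ext (by rw [Fin.val_zero, ← cutSeq_eq hT (by omega)]; exact h0)
    have e1 : Q.orderEmbOfFin hT ⟨1, by omega⟩ = Fin.last n :=
      Fin.ext (by rw [Fin.val_last, ← cutSeq_eq hT (by omega)]; exact h1)
    ext q
    rw [mem_insert, mem_singleton]
    constructor
    · intro hq
      obtain ⟨l, hl, hlq⟩ := cutSeq_surj hT hq
      interval_cases l
      · exact Or.inl (hlq ▸ e0)
      · exact Or.inr (hlq ▸ e1)
    · rintro (rfl | rfl)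
      · exact e0 ▸ Finset.orderEmbOfFin_mem Q hT _
      · exact e1 ▸ Finset.orderEmbOfFin_mem Q hT _
  obtain ⟨u, j₀, hj₀, hlive, hdead⟩ :=
    livenessDesign (g := cutSeq Q hT) c (cutSeq_sep hT hsep) hT1 (cutSeq_le hT _) hn hends'
  refine ⟨u, Q.orderEmbOfFin hT ⟨j₀, hj₀⟩, Finset.orderEmbOfFin_mem Q hT _, hlive _ (cutSeq_eq hT hj₀).symm, ?_⟩
  intro q hq hqne
  obtain ⟨l, hl, hlq⟩ := cutSeq_surj hT hq
  have hlj : l ≠ j₀ := by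
    rintro rfl
    exact hqne hlq.symm
  exact hdead l hl hlj q (by rw [← hlq, cutSeq_eq hT hl])

/-- a completion that refills the block with the pattern already there changes nothing -/
theorem fill_restrict {m : ℕ} (ρ : Fin n → Bool) (T : Fin m ↪ Fin n) : fill ρ T (fun j => ρ (T j)) = ρ := by
  funext i
  by_cases h : ∃ j, T j = i
  · obtain ⟨j, rfl⟩ := h
    exact fill_app ρ T _ j
  · exact fill_off ρ T _ fun j hj => h ⟨j, hj⟩

/-- **LIVENESS DESIGN, block form** (the hypotheses `hlive₀` / `hdead` of part M's `loss_of_designedClassRectangle`): for a 2-separated set `Q` of cuts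
(not the ends pair with `n ≡ c`) and ANY block, some frozen assignment `ρ` and block input `v₀` make one member of `Q` live and all the others dead. -/
theorem livenessDesign_block (c : ℕ) (hn : 2 ≤ n) (Q : Finset (Fin (n + 1))) (hne : Q.Nonempty)
    (hsep : ∀ q ∈ Q, ∀ q' ∈ Q, q < q' → q.val + 2 ≤ q'.val) (hends : ¬ (Q = {0, Fin.last n} ∧ n % 3 = c % 3))
    {m : ℕ} (a₀ : ℕ) (h : a₀ + m ≤ n) :
    ∃ ρ : Fin n → Bool, ∃ v₀ : Fin m → Bool, ∃ g₀ ∈ Q, liveCut c (fill ρ (blockEmb a₀ m h) v₀) g₀ = true ∧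
      ∀ q ∈ Q, q ≠ g₀ → liveCut c (fill ρ (blockEmb a₀ m h) v₀) q = false := by
  obtain ⟨u, g₀, hg₀, hlive, hdead⟩ := livenessDesign_finset c hn Q hne hsep hends
  refine ⟨u, fun j => u (blockEmb a₀ m h j), g₀, hg₀, ?_, ?_⟩
  · rw [fill_restrict]
    exact hlive
  · rw [fill_restrict]
    exact hdead

end FinsetForm

end Summit.QuantumAdvantage.QuantumAdvantage.Theorems.LivenessSeparation
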